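import Mathlib.Analysis.Distribution.Distribution
import Mathlib.Analysis.Distribution.AEEqOfIntegralContDiff
import Mathlib.Analysis.Calculus.VectorField
import Mathlib.Analysis.Calculus.BumpFunction.FiniteDimension
import Mathlib.LinearAlgebra.Trace
import Mathlib.Topology.Algebra.Module.FiniteDimension
import Mathlib.MeasureTheory.Measure.Haar.OfBasis
import Mathlib.MeasureTheory.Measure.Decomposition.RadonNikodym
import HarnessLib

/-!
# Hörmander's hypoellipticity theorem for sums of squares of vector fields (named fact)

Analysis/Distribution support file (serves the discharge of the named fact
`Literature.MathematicalPhysics.KineticTheory.HeatConduction.CuneoEckmannHairerReyBellet2018_smoothDensity` of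
`Literature/MathematicalPhysics/KineticTheory/LangevinChainLyapunov.lean`, provefact unit
`Literature.MathematicalPhysics.KineticTheory.HeatConduction.CuneoEckmannHairerReyBellet2018_pinnedChain`: stationary measures of the
Langevin-driven oscillator chain have smooth densities because the Fokker–Planck operator `L*` is
hypoelliptic).

## Source

L. Hörmander, *Hypoelliptic second order differential equations*, Acta Math. 119 (1967)
147–171 (doi:10.1007/BF02392081).

* p. 147: "A linear differential operator `P` with `C^∞` coefficients in an open set `Ω ⊂ Rⁿ`
  (or a manifold) is called hypoelliptic if for every distribution `u` in `Ω` we have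
  sing supp `u` = sing supp `Pu`, that is, if `u` must be a `C^∞` function in every open set
  where `Pu` is a `C^∞` function."
* p. 149, (1.6): "`P = ∑₁ʳ X_j² + X_0 + c`, where `X_0, …, X_r` denote first order homogeneous
  differential operators in an open set `Ω ⊂ Rⁿ` with `C^∞` coefficients, and `c ∈ C^∞(Ω)`."
* p. 149, **Theorem 1.1**: "Let `P` be written in the form (1.6) and assume that among the
  operators `X_{j₁}, [X_{j₁}, X_{j₂}], [X_{j₁}, [X_{j₂}, X_{j₃}]], …,
  [X_{j₁}, [X_{j₂}, [X_{j₃}, …, X_{j_k}]]]…` where `jᵢ = 0, 1, …, r`, there exist `n` which are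
  linearly independent at any given point in `Ω`. Then it follows that `P` is hypoelliptic."

## What is vendored

* `Literature.fieldDeriv X f = Df · X` (the first-order homogeneous operator `X = ∑ aᵢ ∂ᵢ` of a vector
  field `X : E → E`), `Literature.fieldDiv X = tr DX` (its divergence), `Literature.fieldTranspose X f =
  -X f - (div X) f` (its formal transpose `ᵗX`, `∫ (Xf) g = ∫ f (ᵗX g)`),
  `Literature.hormanderOp X₀ X c f = ∑_j X_j (X_j f) + X₀ f + c f` (the operator `P` of (1.6)) and
  `Literature.hormanderTranspose X₀ X c f = ∑_j ᵗX_j (ᵗX_j f) + ᵗX₀ f + c f` (its formal transpose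
  `ᵗP`); `Literature.IsIteratedLieBracket X V` (the family of iterated brackets of Theorem 1.1, with
  Mathlib's `VectorField.lieBracket`) and `Literature.IsBracketGenerating X s` (they span the whole
  space at every point of `s`).
* Distributions are Mathlib's `𝓓'(Ω, ℝ) = Distribution Ω ℝ ⊤` (continuous linear forms on the
  LF space `𝓓(Ω, ℝ)` of test functions). A differential operator `P` with smooth coefficients
  acts on `𝓓'(Ω)` by transposition, `⟨P u, φ⟩ = ⟨u, ᵗP φ⟩`; accordingly
  `Literature.Distribution.IsSmoothOn u μ U` ("`u|_U ∈ C^∞(U)`": `⟨u, φ⟩ = ∫ g φ dμ` for `φ` supported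
  in `U`, `g` smooth on `U`), `Literature.Distribution.ImageIsSmoothOn u ᵗP μ U` ("`(Pu)|_U ∈ C^∞(U)`":
  `⟨u, ᵗPφ⟩ = ∫ f φ dμ`) and `Literature.IsHypoellipticOn ᵗP Ω μ` (Hörmander's definition, p. 147,
  the operator being recorded through its formal transpose acting on test functions). The
  reference measure `μ` is any additive Haar measure of the finite-dimensional space `E`
  (Lebesgue measure for `E = Rⁿ`; the notions do not depend on the normalisation).
* `Literature.Analysis.Distribution.Hormander1967_thm11` — NAMED FACT, Theorem 1.1: for smooth vector fields `X₀, …, X_r`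
  and a smooth function `c` on a finite-dimensional real space `E` whose iterated brackets span
  `E` at every point of the open set `Ω`, the operator `P = ∑ X_j² + X₀ + c` is hypoelliptic in
  `Ω`.
* PROVED glue for consumers: `ᵗP φ` is again a test function
  (`Literature.Analysis.Distribution.hormanderTransposeTestFunction`); a locally finite Borel measure is a distribution
  (`Literature.Analysis.Distribution.measureDistribution`); a locally finite measure whose distribution is a smooth (indeed
  continuous) function `g` IS the measure `g · μ` with `g ≥ 0`
  (`Literature.Analysis.Distribution.nonneg_of_forall_integral_eq_integral_mul`, `Literature.Analysis.Distribution.eq_withDensity_of_forall_integral_eq`,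
  `Literature.Analysis.Distribution.IsSmoothOn.exists_eq_withDensity`) — the step from "the invariant measure,
  read as a distribution, is `C^∞`" to "the invariant measure has a smooth density".

## Mathlib status

Mathlib (this pin) has test functions and distributions (`Mathlib/Analysis/Distribution/`,
A. Dedecker 2025: the LF topology, `TestFunction.integralAgainstBilinCLM`, derivatives of
distributions along constant vectors), the Lie bracket of vector fields
(`VectorField.lieBracket`), and the fundamental lemma of the calculus of variations
(`ae_eq_of_integral_contDiff_smul_eq`); it has no differential operators with variable
coefficients acting on distributions, no notion of hypoellipticity, no Sobolev/pseudo-differential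
calculus of the kind used in Hörmander's proof (§§3–5). Searched: `hypoellip`, `Hormander`,
`divergence` (only the divergence theorem; `Literature.Analysis.FluidPDE.VectorCalculus.divergence` of
`Literature/Analysis/FluidPDE/VectorCalculus.lean` is the same trace formula but assumes an inner
product space, which the sup-normed phase spaces of the kinetic-theory files are not).

## Design choices and wording risks

* The vector fields and `c` are assumed smooth on all of `E` (Hörmander: smooth on `Ω`); the
  bracket condition is assumed on `Ω` only and the conclusion is hypoellipticity in `Ω`. This is
  the special case of Theorem 1.1 for globally smooth coefficients, which is all the consumers
  need; it keeps `ᵗP φ` a test function on `Ω` without extension arguments.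
* "there exist `n` which are linearly independent at any given point" (`n = dim E`) is rendered
  as: the values at `x` of all iterated brackets span `E` (`Submodule.span ℝ … = ⊤`), for every
  `x ∈ Ω`.
* Hypoellipticity quantifies over ALL distributions `u ∈ 𝓓'(Ω)` (continuity for the LF
  topology is part of Mathlib's `𝓓'`), and over all open `U ⊆ Ω`: if `⟨u, ᵗPφ⟩ = ∫ f φ dμ`
  for all test functions `φ` supported in `U`, with `f ∈ C^∞(U)`, then `⟨u, φ⟩ = ∫ g φ dμ` for
  all such `φ`, with `g ∈ C^∞(U)`. The equation `⇑ψ = ᵗP φ` determines the test function `ψ`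
  (`TestFunction.ext`), and such a `ψ` exists (`hormanderTransposeTestFunction`), so the
  hypothesis is never vacuous.
* `fieldDeriv`/`fieldDiv` inherit the junk value `0` of `fderiv` at points of
  non-differentiability; they are only ever applied to smooth data here.
* Declarations live in `namespace Literature` (`Literature.Distribution.…` is NOT Mathlib's `Distribution`
  namespace but `Literature.Distribution`, used for dot-free grouping only).

## References

* L. Hörmander, *Hypoelliptic second order differential equations*, Acta Math. 119 (1967)
  147–171, Theorem 1.1.
* L. Hörmander, *The Analysis of Linear Partial Differential Operators I*, 2nd ed. (1990),
  Def. 4.1.1 ff. (distributions given by functions and measures), §11.1 (hypoellipticity).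
-/

noncomputable section

open MeasureTheory TopologicalSpace Set Function Distributions
open scoped ContDiff

namespace Literature.Analysis.Distribution

variable {E : Type*} [NormedAddCommGroup E] [NormedSpace ℝ E]

/-! ### First-order operators of vector fields, divergence, formal transposes -/

/-- The first-order homogeneous differential operator of the vector field `X` applied to `f`:
`(X f)(x) = Df(x) · X(x) = ∑ᵢ aᵢ(x) ∂ᵢ f(x)` for `X = ∑ᵢ aᵢ ∂ᵢ` (Hörmander 1967, (1.6): "first
order homogeneous differential operators … with `C^∞` coefficients"). Junk value `0` where `f`
is not differentiable (from `fderiv`). [cite: Hormander1967, eq. (1.6)] -/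
def fieldDeriv (X : E → E) (f : E → ℝ) (x : E) : ℝ :=
  fderiv ℝ f x (X x)

/-- The divergence `div X (x) = tr DX(x) = ∑ᵢ ∂ᵢ aᵢ(x)` of the vector field `X = ∑ᵢ aᵢ ∂ᵢ`
(the trace of its Fréchet derivative; the same formula as `Literature.Analysis.FluidPDE.VectorCalculus.divergence`, here for a
general normed space). Junk value `0` where `X` is not differentiable. [folklore] -/
def fieldDiv (X : E → E) (x : E) : ℝ :=
  LinearMap.trace ℝ E (fderiv ℝ X x : E →ₗ[ℝ] E)

/-- The formal transpose `ᵗX f = -X f - (div X) f` of the first-order operator `X`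
(`∫ (X f) g dx = ∫ f (ᵗX g) dx` for compactly supported smooth `f, g`). [folklore] -/
def fieldTranspose (X : E → E) (f : E → ℝ) (x : E) : ℝ :=
  -fieldDeriv X f x - fieldDiv X x * f x

variable {ι : Type*} [Fintype ι]

/-- Hörmander's operator (1.6): `P f = ∑_j X_j (X_j f) + X₀ f + c f` for vector fields
`X₀, (X_j)_{j ∈ ι}` and a function `c`. [cite: Hormander1967, eq. (1.6)] -/
def hormanderOp (X₀ : E → E) (X : ι → E → E) (c : E → ℝ) (f : E → ℝ) (x : E) : ℝ :=
  (∑ j, fieldDeriv (X j) (fieldDeriv (X j) f) x) + fieldDeriv X₀ f x + c x * f x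

/-- The formal transpose `ᵗP f = ∑_j ᵗX_j (ᵗX_j f) + ᵗX₀ f + c f` of Hörmander's operator
(1.6) (`∫ (P f) g dx = ∫ f (ᵗP g) dx`); a differential operator acts on distributions through
it, `⟨P u, φ⟩ = ⟨u, ᵗP φ⟩`. [folklore] -/
def hormanderTranspose (X₀ : E → E) (X : ι → E → E) (c : E → ℝ) (f : E → ℝ) (x : E) : ℝ :=
  (∑ j, fieldTranspose (X j) (fieldTranspose (X j) f) x) + fieldTranspose X₀ f x + c x * f x

/-! ### The bracket condition -/

/-- The iterated Lie brackets of a family of vector fields `(X_i)_{i ∈ κ}` in the sense of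
Hörmander's Theorem 1.1: the `X_i` themselves and all `[X_{i₁}, [X_{i₂}, [ …, X_{i_k}]…]]`
(Mathlib's `VectorField.lieBracket ℝ V W = DW · V - DV · W`). [cite: Hormander1967, Thm 1.1] -/
inductive IsIteratedLieBracket {κ : Type*} (X : κ → E → E) : (E → E) → Prop
  | of (i : κ) : IsIteratedLieBracket X (X i)
  | lieBracket (i : κ) {V : E → E} :
      IsIteratedLieBracket X V → IsIteratedLieBracket X (VectorField.lieBracket ℝ (X i) V)

/-- Hörmander's bracket condition on the set `s`: at every point `x ∈ s` the values of the
iterated Lie brackets of the family `X` span the whole space ("there exist `n` which are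
linearly independent at any given point"). [cite: Hormander1967, Thm 1.1] -/
def IsBracketGenerating {κ : Type*} (X : κ → E → E) (s : Set E) : Prop :=
  ∀ x ∈ s, Submodule.span ℝ {v : E | ∃ V : E → E, IsIteratedLieBracket X V ∧ V x = v} = ⊤

/-! ### Distributions equal to smooth functions; hypoellipticity -/

section Distributions

variable [MeasurableSpace E] {Ω : Opens E}

/-- `u|_U ∈ C^∞(U)` for a distribution `u ∈ 𝓓'(Ω)` and an open `U ⊆ Ω`: there is `g`, smooth
on `U`, with `⟨u, φ⟩ = ∫ g φ dμ` for every test function `φ` supported in `U` (Hörmander 1967,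
p. 147: "`u` [is] a `C^∞` function in [the] open set"). [folklore] -/
def IsSmoothOn (u : 𝓓'(Ω, ℝ)) (μ : Measure E) (U : Set E) : Prop :=
  ∃ g : E → ℝ, ContDiffOn ℝ ∞ g U ∧
    ∀ φ : 𝓓(Ω, ℝ), tsupport (φ : E → ℝ) ⊆ U → u φ = ∫ x, g x * φ x ∂μ

/-- `(P u)|_U ∈ C^∞(U)` for a distribution `u ∈ 𝓓'(Ω)`, where the differential operator `P`
is recorded through its formal transpose `tP` acting on test functions
(`⟨P u, φ⟩ = ⟨u, ᵗP φ⟩`): there is `f`, smooth on `U`, with `⟨u, ψ⟩ = ∫ f φ dμ` whenever `φ` is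
a test function supported in `U` and `ψ` is the test function `ᵗP φ`. [folklore] -/
def ImageIsSmoothOn (u : 𝓓'(Ω, ℝ)) (tP : (E → ℝ) → E → ℝ) (μ : Measure E)
    (U : Set E) : Prop :=
  ∃ f : E → ℝ, ContDiffOn ℝ ∞ f U ∧
    ∀ φ ψ : 𝓓(Ω, ℝ), tsupport (φ : E → ℝ) ⊆ U → (ψ : E → ℝ) = tP φ →
      u ψ = ∫ x, f x * φ x ∂μ

variable (Ω) in
/-- **Hypoellipticity** (Hörmander 1967, p. 147) of the differential operator `P` in `Ω`, `P`
being recorded through its formal transpose `tP` on test functions: for every distribution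
`u ∈ 𝓓'(Ω)` and every open `U ⊆ Ω`, if `P u` is a `C^∞` function in `U` then so is `u`
("sing supp `u` = sing supp `Pu`"; the inclusion `⊇` is automatic).
[cite: Hormander1967, p. 147] -/
def IsHypoellipticOn (tP : (E → ℝ) → E → ℝ) (μ : Measure E) : Prop :=
  ∀ (u : 𝓓'(Ω, ℝ)) (U : Set E), IsOpen U → U ⊆ (Ω : Set E) →
    Distribution.ImageIsSmoothOn u tP μ U → Distribution.IsSmoothOn u μ U

end Distributions

/-! ### The named fact -/

/-- NAMED FACT — **Hörmander 1967, Theorem 1.1 (hypoellipticity of sums of squares).** Let `E`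
be a finite-dimensional real vector space (`Rⁿ`) with an additive Haar (Lebesgue) measure `μ`,
`Ω ⊆ E` open, `X₀, X₁, …, X_r` smooth real vector fields and `c` a smooth real function, and
`P = ∑_{j=1}^r X_j² + X₀ + c` (form (1.6)). "Assume that among the operators
`X_{j₁}, [X_{j₁}, X_{j₂}], [X_{j₁}, [X_{j₂}, X_{j₃}]], …, [X_{j₁}, [X_{j₂}, [X_{j₃}, …, X_{j_k}]]]…`
where `jᵢ = 0, 1, …, r`, there exist `n` which are linearly independent at any given point in
`Ω`. Then it follows that `P` is hypoelliptic": for every distribution `u ∈ 𝓓'(Ω)` and every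
open `U ⊆ Ω`, if `P u ∈ C^∞(U)` (i.e. `⟨u, ᵗPφ⟩ = ∫ f φ dμ` for `φ ∈ C_c^∞(U)`, `f ∈ C^∞(U)`)
then `u ∈ C^∞(U)` (`⟨u, φ⟩ = ∫ g φ dμ`, `g ∈ C^∞(U)`). Vendored for coefficients smooth on
all of `E` (the printed theorem allows coefficients smooth on `Ω` only). The family of
Theorem 1.1 is indexed here by `Option ι` (`none ↦ X₀`, `some j ↦ X_j`).
[cite: Hormander1967, Thm 1.1] -/
def Hormander1967_thm11 : Prop :=
  ∀ (E : Type) [NormedAddCommGroup E] [NormedSpace ℝ E] [FiniteDimensional ℝ E]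
    [MeasurableSpace E] [BorelSpace E] (μ : Measure E) [μ.IsAddHaarMeasure]
    (ι : Type) [Fintype ι] (Ω : Opens E) (X₀ : E → E) (X : ι → E → E) (c : E → ℝ),
    ContDiff ℝ ∞ X₀ → (∀ j, ContDiff ℝ ∞ (X j)) → ContDiff ℝ ∞ c →
    IsBracketGenerating (fun o : Option ι => o.elim X₀ X) (Ω : Set E) →
    IsHypoellipticOn Ω (hormanderTranspose X₀ X c) μ

/-! ### API: smoothness and support of `X f`, `div X`, `ᵗX f`, `ᵗP f` -/

section Smooth

omit [Fintype ι] in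
/-- Unfolding `fieldDeriv`. [folklore] -/
@[simp] theorem fieldDeriv_apply (X : E → E) (f : E → ℝ) (x : E) :
    fieldDeriv X f x = fderiv ℝ f x (X x) := rfl

/-- `X f` is smooth for smooth `X`, `f`. [folklore] -/
theorem contDiff_fieldDeriv {X : E → E} {f : E → ℝ} (hX : ContDiff ℝ ∞ X)
    (hf : ContDiff ℝ ∞ f) : ContDiff ℝ ∞ (fieldDeriv X f) :=
  (hf.fderiv_right (m := ∞) (by exact_mod_cast le_top)).clm_apply hX

/-- `X f` vanishes where `f` vanishes identically nearby: `tsupport (X f) ⊆ tsupport f`.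
[folklore] -/
theorem tsupport_fieldDeriv_subset (X : E → E) (f : E → ℝ) :
    tsupport (fieldDeriv X f) ⊆ tsupport f := by
  refine (tsupport_fderiv_subset ℝ (f := f)).trans' (closure_mono fun x hx => ?_)
  rw [mem_support] at hx ⊢
  intro h
  exact hx (by simp [fieldDeriv, h])

variable [FiniteDimensional ℝ E]

/-- The trace, as a continuous linear form on `E →L[ℝ] E` (finite dimension). [folklore] -/
def traceCLM : (E →L[ℝ] E) →L[ℝ] ℝ :=
  LinearMap.toContinuousLinearMap ((LinearMap.trace ℝ E).comp (ContinuousLinearMap.coeLM ℝ))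

omit [Fintype ι] in
/-- `traceCLM L = tr L`. [folklore] -/
@[simp] theorem traceCLM_apply (L : E →L[ℝ] E) :
    traceCLM L = LinearMap.trace ℝ E (L : E →ₗ[ℝ] E) := rfl

omit [Fintype ι] in
/-- `div X = tr ∘ DX`. [folklore] -/
theorem fieldDiv_eq_traceCLM_comp (X : E → E) : fieldDiv X = traceCLM ∘ fderiv ℝ X := rfl

/-- `div X` is smooth for smooth `X`. [folklore] -/
theorem contDiff_fieldDiv {X : E → E} (hX : ContDiff ℝ ∞ X) : ContDiff ℝ ∞ (fieldDiv X) := by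
  rw [fieldDiv_eq_traceCLM_comp]
  exact traceCLM.contDiff.comp (hX.fderiv_right (m := ∞) (by exact_mod_cast le_top))

/-- `ᵗX f` is smooth for smooth `X`, `f`. [folklore] -/
theorem contDiff_fieldTranspose {X : E → E} {f : E → ℝ} (hX : ContDiff ℝ ∞ X)
    (hf : ContDiff ℝ ∞ f) : ContDiff ℝ ∞ (fieldTranspose X f) :=
  (contDiff_fieldDeriv hX hf).neg.sub ((contDiff_fieldDiv hX).mul hf)

omit [FiniteDimensional ℝ E] in
/-- `tsupport (ᵗX f) ⊆ tsupport f`. [folklore] -/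
theorem tsupport_fieldTranspose_subset (X : E → E) (f : E → ℝ) :
    tsupport (fieldTranspose X f) ⊆ tsupport f := by
  have h1 : support (fieldTranspose X f) ⊆ support (fieldDeriv X f) ∪ support f := by
    intro x hx
    rw [mem_support] at hx
    by_contra h
    simp only [mem_union, mem_support, not_or, not_not] at h
    exact hx (by rw [fieldTranspose, h.1, h.2]; ring)
  refine (closure_mono h1).trans ?_
  rw [closure_union]
  exact union_subset (tsupport_fieldDeriv_subset X f) Subset.rfl

/-- `ᵗP f` is smooth for smooth data. [folklore] -/
theorem contDiff_hormanderTranspose {X₀ : E → E} {X : ι → E → E} {c f : E → ℝ}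
    (hX₀ : ContDiff ℝ ∞ X₀) (hX : ∀ j, ContDiff ℝ ∞ (X j)) (hc : ContDiff ℝ ∞ c)
    (hf : ContDiff ℝ ∞ f) : ContDiff ℝ ∞ (hormanderTranspose X₀ X c f) := by
  unfold hormanderTranspose
  exact ((ContDiff.sum fun j _ => contDiff_fieldTranspose (hX j)
    (contDiff_fieldTranspose (hX j) hf)).add (contDiff_fieldTranspose hX₀ hf)).add (hc.mul hf)

omit [FiniteDimensional ℝ E] in
/-- `tsupport (ᵗP f) ⊆ tsupport f`. [folklore] -/
theorem tsupport_hormanderTranspose_subset (X₀ : E → E) (X : ι → E → E) (c f : E → ℝ) :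
    tsupport (hormanderTranspose X₀ X c f) ⊆ tsupport f := by
  have h1 : support (hormanderTranspose X₀ X c f) ⊆
      (⋃ j, support (fieldTranspose (X j) (fieldTranspose (X j) f))) ∪
        support (fieldTranspose X₀ f) ∪ support f := by
    intro x hx
    rw [mem_support] at hx
    by_contra h
    simp only [mem_union, mem_iUnion, mem_support, not_or, not_exists, not_not] at h
    exact hx (by simp [hormanderTranspose, h.1.1, h.1.2, h.2])
  refine (closure_mono h1).trans ?_
  rw [closure_union, closure_union, closure_iUnion_of_finite]
  refine union_subset (union_subset (iUnion_subset fun j => ?_)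
    (tsupport_fieldTranspose_subset X₀ f)) Subset.rfl
  exact (tsupport_fieldTranspose_subset _ _).trans (tsupport_fieldTranspose_subset _ _)

variable {Ω : Opens E}

/-- For smooth data, `ᵗP φ` is again a test function on `Ω` (so the hypothesis of
`IsHypoellipticOn` is never vacuous). [folklore] -/
def hormanderTransposeTestFunction {X₀ : E → E} {X : ι → E → E} {c : E → ℝ}
    (hX₀ : ContDiff ℝ ∞ X₀) (hX : ∀ j, ContDiff ℝ ∞ (X j)) (hc : ContDiff ℝ ∞ c)
    (φ : 𝓓(Ω, ℝ)) : 𝓓(Ω, ℝ) :=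
  ⟨hormanderTranspose X₀ X c φ, contDiff_hormanderTranspose hX₀ hX hc φ.contDiff,
    φ.hasCompactSupport.mono'
      ((subset_tsupport _).trans (tsupport_hormanderTranspose_subset X₀ X c φ)),
    (tsupport_hormanderTranspose_subset X₀ X c φ).trans φ.tsupport_subset⟩

/-- The test function `ᵗP φ` is `ᵗP φ`. [folklore] -/
@[simp] theorem coe_hormanderTransposeTestFunction {X₀ : E → E} {X : ι → E → E} {c : E → ℝ}
    (hX₀ : ContDiff ℝ ∞ X₀) (hX : ∀ j, ContDiff ℝ ∞ (X j)) (hc : ContDiff ℝ ∞ c)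
    (φ : 𝓓(Ω, ℝ)) :
    (hormanderTransposeTestFunction hX₀ hX hc φ : E → ℝ) = hormanderTranspose X₀ X c φ := rfl

end Smooth

/-! ### API: measures as distributions, and distributions of measures that are functions -/

section Measures

variable [MeasurableSpace E] [BorelSpace E] {Ω : Opens E}

/-- The distribution `φ ↦ ∫ φ dm` on `Ω` of a Borel measure `m` on `E` (meaningful when `m` is
locally finite on `Ω`; Mathlib's `TestFunction.integralAgainstBilinCLM` with the zero junk value
otherwise). [folklore] -/
def measureDistribution (m : Measure E) (Ω : Opens E) : 𝓓'(Ω, ℝ) :=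
  (TestFunction.integralAgainstBilinCLM (ContinuousLinearMap.mul ℝ ℝ) m (fun _ : E => (1 : ℝ)) :
    𝓓(Ω, ℝ) →L[ℝ] ℝ)

/-- `⟨m, φ⟩ = ∫ φ dm` for a locally finite measure `m`. [folklore] -/
theorem measureDistribution_apply (m : Measure E) [IsLocallyFiniteMeasure m] (φ : 𝓓(Ω, ℝ)) :
    measureDistribution m Ω φ = ∫ x, φ x ∂m := by
  have h : LocallyIntegrableOn (fun _ : E => (1 : ℝ)) (Ω : Set E) m := locallyIntegrableOn_const 1
  change TestFunction.integralAgainstBilinCLM (ContinuousLinearMap.mul ℝ ℝ) m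
    (fun _ : E => (1 : ℝ)) φ = _
  rw [TestFunction.integralAgainstBilinCLM_eq_integral h]
  simp

variable [FiniteDimensional ℝ E]

/-- If a locally finite measure `m` integrates every smooth compactly supported `φ` to
`∫ g φ dμ` with `g` continuous and `μ` a Haar measure, then `g ≥ 0` (test against a smooth bump
at a point where `g < 0`). [folklore] -/
theorem nonneg_of_forall_integral_eq_integral_mul {m : Measure E} (μ : Measure E)
    [μ.IsAddHaarMeasure] {g : E → ℝ} (hg : Continuous g)
    (h : ∀ φ : E → ℝ, ContDiff ℝ ∞ φ → HasCompactSupport φ →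
      ∫ x, φ x ∂m = ∫ x, g x * φ x ∂μ) (x : E) : 0 ≤ g x := by
  by_contra hx
  rw [not_le] at hx
  have hS : g ⁻¹' Iio 0 ∈ nhds x := (isOpen_Iio.preimage hg).mem_nhds hx
  obtain ⟨φ, hφS, hφc, hφd, hφr, hφx⟩ := exists_contDiff_tsupport_subset (n := (⊤ : ℕ∞)) hS
  have hφ0 : ∀ y, 0 ≤ φ y := fun y => (hφr ⟨y, rfl⟩).1
  have h1 : 0 ≤ ∫ y, φ y ∂m := integral_nonneg hφ0
  -- the integrand `(-g) φ` is continuous, compactly supported, nonnegative and nonzero at `x`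
  set k : E → ℝ := fun y => -g y * φ y with hk
  have hkc : Continuous k := hg.neg.mul hφd.continuous
  have hks : HasCompactSupport k := hφc.mul_left
  have hk0 : 0 ≤ k := by
    intro y
    simp only [hk, Pi.zero_apply]
    by_cases hy : φ y = 0
    · simp [hy]
    · have hyS : y ∈ g ⁻¹' Iio 0 := hφS (subset_tsupport _ (mem_support.2 hy))
      exact mul_nonneg (neg_nonneg.2 (le_of_lt hyS)) (hφ0 y)
  have hkx : k x ≠ 0 := by
    simp only [hk, hφx, mul_one, ne_eq, neg_eq_zero]
    exact hx.ne
  have h2 : 0 < ∫ y, k y ∂μ := hkc.integral_pos_of_hasCompactSupport_nonneg_nonzero hks hk0 hkx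
  have h3 : ∫ y, g y * φ y ∂μ = -∫ y, k y ∂μ := by
    rw [← integral_neg]
    refine integral_congr_ae (Filter.Eventually.of_forall fun y => ?_)
    simp only [hk]
    ring
  have := h φ hφd hφc
  linarith

/-- **A locally finite measure whose distribution is a continuous function `g` (with respect to
a Haar measure `μ`) is `g · μ`, and `g ≥ 0`**: if `∫ φ dm = ∫ g φ dμ` for all smooth compactly
supported `φ`, then `0 ≤ g` and `m = μ.withDensity g`. (Positivity: previous lemma. Equality:
both `m` and `g · μ` are absolutely continuous with respect to `λ = m + g · μ`, and their
densities have the same integrals against test functions, so they agree `λ`-a.e. by the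
fundamental lemma of the calculus of variations, Mathlib's
`ae_eq_of_integral_contDiff_smul_eq`.) [folklore] -/
theorem eq_withDensity_of_forall_integral_eq {m : Measure E} [IsLocallyFiniteMeasure m]
    (μ : Measure E) [μ.IsAddHaarMeasure] {g : E → ℝ} (hg : Continuous g)
    (h : ∀ φ : E → ℝ, ContDiff ℝ ∞ φ → HasCompactSupport φ →
      ∫ x, φ x ∂m = ∫ x, g x * φ x ∂μ) :
    (∀ x, 0 ≤ g x) ∧ m = μ.withDensity fun x => ENNReal.ofReal (g x) := by
  have hg0 : ∀ x, 0 ≤ g x := nonneg_of_forall_integral_eq_integral_mul μ hg h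
  refine ⟨hg0, ?_⟩
  set ν : Measure E := μ.withDensity fun x => ENNReal.ofReal (g x) with hν
  haveI : IsLocallyFiniteMeasure ν := IsLocallyFiniteMeasure.withDensity_ofReal hg
  set lam : Measure E := m + ν with hlam
  have hmlam : m ≪ lam := Measure.absolutelyContinuous_of_le (Measure.le_add_right le_rfl)
  have hνlam : ν ≪ lam := Measure.absolutelyContinuous_of_le (Measure.le_add_left le_rfl)
  have hlamK : ∀ K : Set E, IsCompact K → lam K < ⊤ := fun K hK => by
    rw [hlam, Measure.add_apply]
    exact ENNReal.add_lt_top.2 ⟨hK.measure_lt_top, hK.measure_lt_top⟩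
  -- densities with respect to `lam`
  set a : E → ℝ := fun x => (m.rnDeriv lam x).toReal with ha
  set b : E → ℝ := fun x => (ν.rnDeriv lam x).toReal with hb
  have hloc : ∀ (ρ : Measure E) [IsLocallyFiniteMeasure ρ], ρ ≪ lam →
      (∀ K, IsCompact K → ρ K < ⊤) →
      LocallyIntegrable (fun x => (ρ.rnDeriv lam x).toReal) lam := by
    intro ρ _ hρ hρK
    rw [locallyIntegrable_iff]
    intro K hK
    refine integrable_toReal_of_lintegral_ne_top
      (Measure.measurable_rnDeriv ρ lam).aemeasurable ?_
    rw [Measure.setLIntegral_rnDeriv hρ]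
    exact (hρK K hK).ne
  have haloc : LocallyIntegrable a lam :=
    hloc m hmlam fun K hK => hK.measure_lt_top
  have hbloc : LocallyIntegrable b lam :=
    hloc ν hνlam fun K hK => hK.measure_lt_top
  -- both densities integrate test functions like `m`, resp. `ν`
  have hab : ∀ᵐ x ∂lam, a x = b x := by
    refine ae_eq_of_integral_contDiff_smul_eq haloc hbloc fun φ hφ hφc => ?_
    have e1 : ∫ x, φ x • a x ∂lam = ∫ x, φ x ∂m := by
      rw [← integral_rnDeriv_smul hmlam]
      refine integral_congr_ae (Filter.Eventually.of_forall fun x => ?_)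
      simp only [ha, smul_eq_mul]
      ring
    have e2 : ∫ x, φ x • b x ∂lam = ∫ x, φ x ∂ν := by
      rw [← integral_rnDeriv_smul hνlam]
      refine integral_congr_ae (Filter.Eventually.of_forall fun x => ?_)
      simp only [hb, smul_eq_mul]
      ring
    have e3 : ∫ x, φ x ∂ν = ∫ x, g x * φ x ∂μ := by
      rw [hν, integral_withDensity_eq_integral_toReal_smul (f := fun x => ENNReal.ofReal (g x))
        (ENNReal.measurable_ofReal.comp hg.measurable)
        (Filter.Eventually.of_forall fun x => ENNReal.ofReal_lt_top)]
      refine integral_congr_ae (Filter.Eventually.of_forall fun x => ?_)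
      simp only [smul_eq_mul, ENNReal.toReal_ofReal (hg0 x)]
    rw [e1, e2, e3]
    exact h φ hφ hφc
  -- hence the `ℝ≥0∞`-densities agree a.e., and so do the measures
  have hab' : m.rnDeriv lam =ᵐ[lam] ν.rnDeriv lam := by
    filter_upwards [hab, Measure.rnDeriv_lt_top m lam, Measure.rnDeriv_lt_top ν lam]
      with x hx h1 h2
    exact (ENNReal.toReal_eq_toReal_iff' h1.ne h2.ne).1 hx
  calc m = lam.withDensity (m.rnDeriv lam) := (Measure.withDensity_rnDeriv_eq m lam hmlam).symm
    _ = lam.withDensity (ν.rnDeriv lam) := withDensity_congr_ae hab'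
    _ = ν := Measure.withDensity_rnDeriv_eq ν lam hνlam

/-- **From "the distribution of `m` is smooth" to "`m` has a smooth density".** If the
distribution `φ ↦ ∫ φ dm` (on `Ω = E`) of a locally finite measure `m` is a smooth function on
all of `E` in the sense of `Distribution.IsSmoothOn` (the conclusion of hypoellipticity), then
`m = g · μ` for a smooth `g ≥ 0`. [folklore] -/
theorem IsSmoothOn.exists_eq_withDensity {m : Measure E} [IsLocallyFiniteMeasure m]
    {μ : Measure E} [μ.IsAddHaarMeasure]
    (h : Distribution.IsSmoothOn (measureDistribution m (⊤ : Opens E)) μ univ) :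
    ∃ g : E → ℝ, ContDiff ℝ ∞ g ∧ (∀ x, 0 ≤ g x) ∧
      m = μ.withDensity fun x => ENNReal.ofReal (g x) := by
  obtain ⟨g, hg, hint⟩ := h
  rw [contDiffOn_univ] at hg
  have h' : ∀ φ : E → ℝ, ContDiff ℝ ∞ φ → HasCompactSupport φ →
      ∫ x, φ x ∂m = ∫ x, g x * φ x ∂μ := by
    intro φ hφ hφc
    let ψ : 𝓓((⊤ : Opens E), ℝ) := ⟨φ, hφ, hφc, fun _ _ => trivial⟩
    have := hint ψ (subset_univ _)
    rwa [measureDistribution_apply] at this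
  exact ⟨g, hg, eq_withDensity_of_forall_integral_eq μ hg.continuous h'⟩

end Measures

/-! ### Unfolding the named fact -/

/-- Unfolding `Hormander1967_thm11` on the whole space `Ω = U = E` for a measure: if
`⟨m, ᵗPφ⟩ = ∫ (ᵗPφ) dm = 0` for all test functions `φ` (i.e. `P m = 0` in `𝓓'`) and the
bracket condition holds everywhere, then the locally finite measure `m` has a smooth density
`g ≥ 0` with respect to the Haar measure `μ`. [cite: Hormander1967, Thm 1.1] -/
theorem Hormander1967_thm11.exists_eq_withDensity (hH : Hormander1967_thm11)
    {E : Type} [NormedAddCommGroup E] [NormedSpace ℝ E] [FiniteDimensional ℝ E]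
    [MeasurableSpace E] [BorelSpace E] (μ : Measure E) [μ.IsAddHaarMeasure]
    {ι : Type} [Fintype ι] {X₀ : E → E} {X : ι → E → E} {c : E → ℝ}
    (hX₀ : ContDiff ℝ ∞ X₀) (hX : ∀ j, ContDiff ℝ ∞ (X j)) (hc : ContDiff ℝ ∞ c)
    (hbr : IsBracketGenerating (fun o : Option ι => o.elim X₀ X) univ)
    (m : Measure E) [IsLocallyFiniteMeasure m]
    (hm : ∀ φ : E → ℝ, ContDiff ℝ ∞ φ → HasCompactSupport φ →
      ∫ x, hormanderTranspose X₀ X c φ x ∂m = 0) :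
    ∃ g : E → ℝ, ContDiff ℝ ∞ g ∧ (∀ x, 0 ≤ g x) ∧
      m = μ.withDensity fun x => ENNReal.ofReal (g x) := by
  have hyp := hH E μ ι ⊤ X₀ X c hX₀ hX hc (by simpa using hbr)
  refine IsSmoothOn.exists_eq_withDensity (hyp (measureDistribution m ⊤) univ
    isOpen_univ (subset_univ _) ⟨0, contDiffOn_const, fun φ ψ _ hψ => ?_⟩)
  rw [measureDistribution_apply]
  simp only [Pi.zero_apply, zero_mul, integral_zero]
  have : (fun x => ψ x) = hormanderTranspose X₀ X c φ := hψ
  rw [this]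
  exact hm φ φ.contDiff φ.hasCompactSupport

end Literature.Analysis.Distribution
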